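import Literature.AlgebraicGeometry.Frobenioids.Cor54RigidityModelLemmas
import Literature.AlgebraicGeometry.Frobenioids.ArithmeticRealificationPicDegree
import Literature.NumberTheory.NumberFields.AutomorphismFixingPrimes
import HarnessLib

/-!
# Frobenioids I, Corollary 5.4 at `C_{K/F}`: hom-rigidity of `C^un-tr → C^rlf` — the base component
# (sub-DAG row C54-core-arith, file 4b-i)

Mochizuki, *The geometry of Frobenioids I: the general theory*, Kyushu J. Math. **62** (2008) 293–400,
Corollary 5.4 p. 104 (1-uniqueness of `Ψ^rlf`), at the arithmetic Frobenioids `C_{K/F}` of Example 6.3 /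
Theorem 6.4 pp. 113–116. [cite: MochizukiFrdI2008, Cor. 5.4 p.104]

PROOF-ONLY file (seat abc-iut-w5-d048, L1-lead R111 (2)/R114a; no definitions). With `G = untrToRlf` for
`C_{K/F}` (model descriptions, THE data) and a functorial self-map `ρ` of the morphisms between `G`-image
objects fixing the `G f` (`Cor54RigidityReduction.lean`, `Cor54RigidityModelLemmas.lean`), let
`K = (1, id_A, z, u) : G(A, μ) ⟶ G(A, ν)` and `ρ K = (d̂, σ, ẑ, û)`. This file proves

* **`FrdI.Cor54Sub.baseMap_conj_eq_id_arith` — `σ = id_A`.**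

Conjugating `K` by the image morphisms `G(1, id, N·[v], 0)` (`exists_divHom_conj`) and reading off the
divisor component (`components_of_conj`) gives `ẑ_N · ι(N[v])^d̂ = σ^*(ι(N[v])) · ẑ` in `Φ^rlf(L)` with
`ẑ_N` effective; in abc-iut-L1-d2's injective coordinates `Θ : (Φ^rlf)^gp(L) ↪ ADiv_ℝ(L)` (effective ↦
non-negative) the coefficient at `v` reads `c_N + d̂·N = N · e(v|σ⁻¹v)·[σ⁻¹ v = v] + c`, so `σ⁻¹ v = v` for
EVERY finite place `v` (else `N ≤ c` for all `N`), whence `σ = id` by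
`Literature.NumberTheory.NumberFields.algHom_eq_id_of_forall_comap_heightOneSpectrum` (a field
endomorphism fixing all primes is the identity). Nothing here bears on [IUTchIII] Cor. 3.12.
-/

noncomputable section

namespace Literature.AlgebraicGeometry.Frobenioids

namespace FrdI.Cor54Sub

open CategoryTheory Opposite ModelFrobenioid NumberField IsDedekindDomain Literature.IUT.LogVolume

variable {F : Type} [Field F] [NumberField F] {K : Type} [Field K] [Algebra F K]
  (hΦ : PreFrobenioid.IsPerfFactorialOn (arithDivisorFunctor F K))

/-- The pull-back `Φ(σ)` of `C_{K/F}` on an effective arithmetic divisor, unfolded.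
[cite: MochizukiFrdI2008, Ex. 6.3 p.113] -/
theorem arithDivisorFunctor_map_apply {A B : FinSubextCat F K} (f : A ⟶ B) (D : EffArithDivisor B.L) :
    ((arithDivisorFunctor F K).map f.op).hom (Multiplicative.ofAdd D) =
      Multiplicative.ofAdd (EffArithDivisor.pullback f.toAlgHom.toRingHom D) := rfl

/-- Naturality of `ι : Φ → Φ^rlf` (THE data) at an arrow of the base, elementwise.
[cite: MochizukiFrdI2008, Prop. 5.3 p.103] -/
theorem rlf_map_eta_apply {A B : FinSubextCat F K} (f : A ⟶ B) (x : (arithDivisorFunctor F K).obj (op B)) :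
    ((RealificationData.canonical (arithDivisorFunctor F K) (PreFrobenioid.IsPerfFactorialOn.op hΦ)).rlf.map f.op).hom ((((RealificationData.canonical (arithDivisorFunctor F K) (PreFrobenioid.IsPerfFactorialOn.op hΦ)).ofBaseData (PreFrobenioid.biratSubfunctor (ModelFrobenioid.toElem (arithDivisorFunctor F K) (unitsFunctor F K) (divNatTrans F K)))).η.app (op B)).hom x) = (((RealificationData.canonical (arithDivisorFunctor F K) (PreFrobenioid.IsPerfFactorialOn.op hΦ)).ofBaseData (PreFrobenioid.biratSubfunctor (ModelFrobenioid.toElem (arithDivisorFunctor F K) (unitsFunctor F K) (divNatTrans F K)))).η.app (op A)).hom (((arithDivisorFunctor F K).map f.op).hom x) := by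
  have h := congrArg (fun φ => (CommMonCat.Hom.hom φ) x) (((RealificationData.canonical (arithDivisorFunctor F K) (PreFrobenioid.IsPerfFactorialOn.op hΦ)).ofBaseData (PreFrobenioid.biratSubfunctor (ModelFrobenioid.toElem (arithDivisorFunctor F K) (unitsFunctor F K) (divNatTrans F K)))).η.naturality f.op)
  simp only [CommMonCat.hom_comp, MonoidHom.coe_comp, Function.comp_apply] at h
  exact h.symm

/-- **`σ = id_A`**: for `K = (1, id_A, z, u) : G(A, μ) ⟶ G(A, ν)` between `untrToRlf`-image objects of
`C_{K/F}` and `ρ` a functorial self-map of the homs between image objects fixing the `G f`, the base component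
of `ρ K` is the identity. [cite: MochizukiFrdI2008, Cor. 5.4 p.104] -/
theorem baseMap_conj_eq_id_arith
    (ρ : ∀ ⦃a a' : (PreFrobenioid.biratSubfunctor (ModelFrobenioid.toElem (arithDivisorFunctor F K) (unitsFunctor F K) (divNatTrans F K))).ModelOf⦄, (((RealificationData.canonical (arithDivisorFunctor F K) (PreFrobenioid.IsPerfFactorialOn.op hΦ)).toRlfModel (PreFrobenioid.biratSubfunctor (ModelFrobenioid.toElem (arithDivisorFunctor F K) (unitsFunctor F K) (divNatTrans F K)))).obj a ⟶ ((RealificationData.canonical (arithDivisorFunctor F K) (PreFrobenioid.IsPerfFactorialOn.op hΦ)).toRlfModel (PreFrobenioid.biratSubfunctor (ModelFrobenioid.toElem (arithDivisorFunctor F K) (unitsFunctor F K) (divNatTrans F K)))).obj a') → (((RealificationData.canonical (arithDivisorFunctor F K) (PreFrobenioid.IsPerfFactorialOn.op hΦ)).toRlfModel (PreFrobenioid.biratSubfunctor (ModelFrobenioid.toElem (arithDivisorFunctor F K) (unitsFunctor F K) (divNatTrans F K)))).obj a ⟶ ((RealificationData.canonical (arithDivisorFunctor F K) (PreFrobenioid.IsPerfFactorialOn.op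 hΦ)).toRlfModel (PreFrobenioid.biratSubfunctor (ModelFrobenioid.toElem (arithDivisorFunctor F K) (unitsFunctor F K) (divNatTrans F K)))).obj a'))
    (hcomp : ∀ ⦃a a' a'' : (PreFrobenioid.biratSubfunctor (ModelFrobenioid.toElem (arithDivisorFunctor F K) (unitsFunctor F K) (divNatTrans F K))).ModelOf⦄ (h : ((RealificationData.canonical (arithDivisorFunctor F K) (PreFrobenioid.IsPerfFactorialOn.op hΦ)).toRlfModel (PreFrobenioid.biratSubfunctor (ModelFrobenioid.toElem (arithDivisorFunctor F K) (unitsFunctor F K) (divNatTrans F K)))).obj a ⟶ ((RealificationData.canonical (arithDivisorFunctor F K) (PreFrobenioid.IsPerfFactorialOn.op hΦ)).toRlfModel (PreFrobenioid.biratSubfunctor (ModelFrobenioid.toElem (arithDivisorFunctor F K) (unitsFunctor F K) (divNatTrans F K)))).obj a') (k : ((RealificationData.canonical (arithDivisorFunctor F K) (PreFrobenioid.IsPerfFactorialOn.op hΦ)).toRlfModel (PreFrobenioid.biratSubfunctor (ModelFrobenioid.toElem (arithDivisorFunctor F K) (unitsFunctor F K) (divNatTrans F K)))).obj a' ⟶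 ((RealificationData.canonical (arithDivisorFunctor F K) (PreFrobenioid.IsPerfFactorialOn.op hΦ)).toRlfModel (PreFrobenioid.biratSubfunctor (ModelFrobenioid.toElem (arithDivisorFunctor F K) (unitsFunctor F K) (divNatTrans F K)))).obj a''), ρ (h ≫ k) = ρ h ≫ ρ k)
    (hmap : ∀ ⦃a a' : (PreFrobenioid.biratSubfunctor (ModelFrobenioid.toElem (arithDivisorFunctor F K) (unitsFunctor F K) (divNatTrans F K))).ModelOf⦄ (f : a ⟶ a'), ρ (((RealificationData.canonical (arithDivisorFunctor F K) (PreFrobenioid.IsPerfFactorialOn.op hΦ)).toRlfModel (PreFrobenioid.biratSubfunctor (ModelFrobenioid.toElem (arithDivisorFunctor F K) (unitsFunctor F K) (divNatTrans F K)))).map f) = ((RealificationData.canonical (arithDivisorFunctor F K) (PreFrobenioid.IsPerfFactorialOn.op hΦ)).toRlfModel (PreFrobenioid.biratSubfunctor (ModelFrobenioid.toElem (arithDivisorFunctor F K) (unitsFunctor F K) (divNatTrans F K)))).map f)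
    (A : FinSubextCat F K) (μ ν : Algebra.GrothendieckGroup ((arithDivisorFunctor F K).obj (op A)))
    (K₀ : (⟨A, gpApp ((RealificationData.canonical (arithDivisorFunctor F K) (PreFrobenioid.IsPerfFactorialOn.op hΦ)).ofBaseData (PreFrobenioid.biratSubfunctor (ModelFrobenioid.toElem (arithDivisorFunctor F K) (unitsFunctor F K) (divNatTrans F K)))).η (op A) μ⟩ : ((RealificationData.canonical (arithDivisorFunctor F K) (PreFrobenioid.IsPerfFactorialOn.op hΦ)).realSpan (PreFrobenioid.biratSubfunctor (ModelFrobenioid.toElem (arithDivisorFunctor F K) (unitsFunctor F K) (divNatTrans F K)))).ModelOf) ⟶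
      (⟨A, gpApp ((RealificationData.canonical (arithDivisorFunctor F K) (PreFrobenioid.IsPerfFactorialOn.op hΦ)).ofBaseData (PreFrobenioid.biratSubfunctor (ModelFrobenioid.toElem (arithDivisorFunctor F K) (unitsFunctor F K) (divNatTrans F K)))).η (op A) ν⟩ : ((RealificationData.canonical (arithDivisorFunctor F K) (PreFrobenioid.IsPerfFactorialOn.op hΦ)).realSpan (PreFrobenioid.biratSubfunctor (ModelFrobenioid.toElem (arithDivisorFunctor F K) (unitsFunctor F K) (divNatTrans F K)))).ModelOf))
    (hd : degFr K₀ = 1) (hb : baseMap K₀ = 𝟙 A) :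
    (baseMap (ρ (a := ⟨A, μ⟩) (a' := ⟨A, ν⟩) K₀) : A ⟶ A) = 𝟙 A := by
  -- THE perf-factoriality witness and coordinates at `A`
  have hM : IsPerfFactorial (Multiplicative (EffArithDivisor A.L)) := PreFrobenioid.IsPerfFactorialOn.op hΦ (op A)
  obtain ⟨Θ, hΘinj, hΘι, hΘnn, -⟩ := ArithRlfCoord.exists_rlfGp_coordinates hM
  -- coordinate bookkeeping at a finite place, for products/powers in `Φ^rlf(L)` (the carrier of `R.rlf(A)`)
  have θmul : ∀ (p : Place A.L) (x y : (RealificationData.canonical (arithDivisorFunctor F K) (PreFrobenioid.IsPerfFactorialOn.op hΦ)).rlf.obj (op A)),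
      Multiplicative.toAdd (Θ (Algebra.GrothendieckGroup.of (M := hM.Rlf) (x * y))) p =
        Multiplicative.toAdd (Θ (Algebra.GrothendieckGroup.of (M := hM.Rlf) x)) p +
          Multiplicative.toAdd (Θ (Algebra.GrothendieckGroup.of (M := hM.Rlf) y)) p := by
    intro p x y
    have h : Algebra.GrothendieckGroup.of (M := hM.Rlf) (x * y) =
        Algebra.GrothendieckGroup.of (M := hM.Rlf) x * Algebra.GrothendieckGroup.of (M := hM.Rlf) y :=
      map_mul (Algebra.GrothendieckGroup.of (M := hM.Rlf)) x y
    rw [h, map_mul, toAdd_mul, Finsupp.add_apply]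
  have θpow : ∀ (p : Place A.L) (x : (RealificationData.canonical (arithDivisorFunctor F K) (PreFrobenioid.IsPerfFactorialOn.op hΦ)).rlf.obj (op A)) (n : ℕ),
      Multiplicative.toAdd (Θ (Algebra.GrothendieckGroup.of (M := hM.Rlf) (x ^ n))) p =
        n * Multiplicative.toAdd (Θ (Algebra.GrothendieckGroup.of (M := hM.Rlf) x)) p := by
    intro p x n
    have h : Algebra.GrothendieckGroup.of (M := hM.Rlf) (x ^ n) = Algebra.GrothendieckGroup.of (M := hM.Rlf) x ^ n :=
      map_pow (Algebra.GrothendieckGroup.of (M := hM.Rlf)) x n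
    rw [h, map_pow, toAdd_pow, Finsupp.smul_apply, nsmul_eq_mul]
  set k := ρ (a := ⟨A, μ⟩) (a' := ⟨A, ν⟩) K₀ with hk
  set σ : A ⟶ A := baseMap k with hσ
  -- Step 1: every finite place is fixed by `σ`
  have hfix : ∀ v : HeightOneSpectrum (𝓞 A.L),
      v.asIdeal.comap (RingOfIntegers.mapRingHom (σ.toAlgHom : A.L →+* A.L)) = v.asIdeal := by
    intro v
    by_contra hv
    -- the `v`-coordinate of `Div(ρ K)`
    set c : ℝ := Multiplicative.toAdd (Θ (Algebra.GrothendieckGroup.of (div k))) (Sum.inr v) with hc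
    have key : ∀ N : ℕ, (N : ℝ) ≤ c := by
      intro N
      -- conjugate `K` by `G(1, id, N·[v], 0)`
      let wN : (arithDivisorFunctor F K).obj (op A) :=
        Multiplicative.ofAdd ((Finsupp.single (FinitePlace.mk v) N, 0) : EffArithDivisor A.L)
      obtain ⟨zμ, zν, K', hzμ, hzν, -, hsq⟩ := exists_divHom_conj (RealificationData.canonical (arithDivisorFunctor F K) (PreFrobenioid.IsPerfFactorialOn.op hΦ)) (PreFrobenioid.biratSubfunctor (ModelFrobenioid.toElem (arithDivisorFunctor F K) (unitsFunctor F K) (divNatTrans F K))) A μ ν K₀ hd hb wN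
      have e1 := hcomp (a := ⟨A, μ⟩) (a' := ⟨A, μ * Algebra.GrothendieckGroup.of wN⟩)
        (a'' := ⟨A, ν * Algebra.GrothendieckGroup.of wN⟩) (((RealificationData.canonical (arithDivisorFunctor F K) (PreFrobenioid.IsPerfFactorialOn.op hΦ)).toRlfModel (PreFrobenioid.biratSubfunctor (ModelFrobenioid.toElem (arithDivisorFunctor F K) (unitsFunctor F K) (divNatTrans F K)))).map zμ) K'
      have e2 := hcomp (a := ⟨A, μ⟩) (a' := ⟨A, ν⟩) (a'' := ⟨A, ν * Algebra.GrothendieckGroup.of wN⟩)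
        K₀ (((RealificationData.canonical (arithDivisorFunctor F K) (PreFrobenioid.IsPerfFactorialOn.op hΦ)).toRlfModel (PreFrobenioid.biratSubfunctor (ModelFrobenioid.toElem (arithDivisorFunctor F K) (unitsFunctor F K) (divNatTrans F K)))).map zν)
      have hsq' : ((RealificationData.canonical (arithDivisorFunctor F K) (PreFrobenioid.IsPerfFactorialOn.op hΦ)).toRlfModel (PreFrobenioid.biratSubfunctor (ModelFrobenioid.toElem (arithDivisorFunctor F K) (unitsFunctor F K) (divNatTrans F K)))).map zμ ≫ ρ (a := ⟨A, μ * Algebra.GrothendieckGroup.of wN⟩) (a' := ⟨A, ν * Algebra.GrothendieckGroup.of wN⟩) K' = k ≫ ((RealificationData.canonical (arithDivisorFunctor F K) (PreFrobenioid.IsPerfFactorialOn.op hΦ)).toRlfModel (PreFrobenioid.biratSubfunctor (ModelFrobenioid.toElem (arithDivisorFunctor F K) (unitsFunctor F K) (divNatTrans F K)))).map zν := by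
        calc ((RealificationData.canonical (arithDivisorFunctor F K) (PreFrobenioid.IsPerfFactorialOn.op hΦ)).toRlfModel (PreFrobenioid.biratSubfunctor (ModelFrobenioid.toElem (arithDivisorFunctor F K) (unitsFunctor F K) (divNatTrans F K)))).map zμ ≫ ρ (a := ⟨A, μ * Algebra.GrothendieckGroup.of wN⟩) (a' := ⟨A, ν * Algebra.GrothendieckGroup.of wN⟩) K'
            = ρ (((RealificationData.canonical (arithDivisorFunctor F K) (PreFrobenioid.IsPerfFactorialOn.op hΦ)).toRlfModel (PreFrobenioid.biratSubfunctor (ModelFrobenioid.toElem (arithDivisorFunctor F K) (unitsFunctor F K) (divNatTrans F K)))).map zμ) ≫ ρ (a := ⟨A, μ * Algebra.GrothendieckGroup.of wN⟩) (a' := ⟨A, ν * Algebra.GrothendieckGroup.of wN⟩) K' := by rw [hmap]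
          _ = ρ (a := ⟨A, μ⟩) (a' := ⟨A, ν * Algebra.GrothendieckGroup.of wN⟩) (((RealificationData.canonical (arithDivisorFunctor F K) (PreFrobenioid.IsPerfFactorialOn.op hΦ)).toRlfModel (PreFrobenioid.biratSubfunctor (ModelFrobenioid.toElem (arithDivisorFunctor F K) (unitsFunctor F K) (divNatTrans F K)))).map zμ ≫ K') := e1.symm
          _ = ρ (a := ⟨A, μ⟩) (a' := ⟨A, ν * Algebra.GrothendieckGroup.of wN⟩) (K₀ ≫ ((RealificationData.canonical (arithDivisorFunctor F K) (PreFrobenioid.IsPerfFactorialOn.op hΦ)).toRlfModel (PreFrobenioid.biratSubfunctor (ModelFrobenioid.toElem (arithDivisorFunctor F K) (unitsFunctor F K) (divNatTrans F K)))).map zν) :=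
              congrArg _ hsq
          _ = k ≫ ρ (((RealificationData.canonical (arithDivisorFunctor F K) (PreFrobenioid.IsPerfFactorialOn.op hΦ)).toRlfModel (PreFrobenioid.biratSubfunctor (ModelFrobenioid.toElem (arithDivisorFunctor F K) (unitsFunctor F K) (divNatTrans F K)))).map zν) := e2
          _ = k ≫ ((RealificationData.canonical (arithDivisorFunctor F K) (PreFrobenioid.IsPerfFactorialOn.op hΦ)).toRlfModel (PreFrobenioid.biratSubfunctor (ModelFrobenioid.toElem (arithDivisorFunctor F K) (unitsFunctor F K) (divNatTrans F K)))).map zν := by rw [hmap]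
      obtain ⟨-, -, hdiv⟩ := components_of_conj (RealificationData.canonical (arithDivisorFunctor F K) (PreFrobenioid.IsPerfFactorialOn.op hΦ)) (PreFrobenioid.biratSubfunctor (ModelFrobenioid.toElem (arithDivisorFunctor F K) (unitsFunctor F K) (divNatTrans F K))) A μ ν wN zμ hzμ zν hzν k (ρ (a := ⟨A, μ * Algebra.GrothendieckGroup.of wN⟩) (a' := ⟨A, ν * Algebra.GrothendieckGroup.of wN⟩) K') hsq'
      -- `Φ^rlf(σ)(ι w_N) = ι(σ^* w_N)`
      rw [rlf_map_eta_apply hΦ σ wN, arithDivisorFunctor_map_apply] at hdiv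
      -- read the `v`-coordinate through `Θ ∘ of : Φ^rlf(L) → ADiv_ℝ(L)`
      have hcoord := congrArg
        (fun x : (RealificationData.canonical (arithDivisorFunctor F K) (PreFrobenioid.IsPerfFactorialOn.op hΦ)).rlf.obj (op A) =>
          Multiplicative.toAdd (Θ (Algebra.GrothendieckGroup.of (M := hM.Rlf) x)) (Sum.inr v)) hdiv
      simp only [] at hcoord
      rw [θmul, θpow, θmul] at hcoord
      -- the two `ι`-terms in coordinates
      have hιN : Multiplicative.toAdd (Θ (Algebra.GrothendieckGroup.of (M := hM.Rlf)
          ((((RealificationData.canonical (arithDivisorFunctor F K) (PreFrobenioid.IsPerfFactorialOn.op hΦ)).ofBaseData (PreFrobenioid.biratSubfunctor (ModelFrobenioid.toElem (arithDivisorFunctor F K) (unitsFunctor F K) (divNatTrans F K)))).η.app (op A)).hom wN))) (Sum.inr v) = N := by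
        have h := congrArg (fun y : Multiplicative (ADivisor A.L) => Multiplicative.toAdd y (Sum.inr v))
          (hΘι ((Finsupp.single (FinitePlace.mk v) N, 0) : EffArithDivisor A.L))
        simp only [toAdd_ofAdd, ADivisor.ofArithDivisor_apply_inr, EffArithDivisor.toArithDivisor_fst,
          Finsupp.single_eq_same, Int.cast_natCast] at h
        exact h
      have hne : ArithPullback.underPlace σ.toAlgHom.toRingHom (FinitePlace.mk v) ≠ FinitePlace.mk v := by
        intro h'
        apply hv
        have h'' := congrArg FinitePlace.maximalIdeal h'
        simp only [ArithPullback.underPlace, FinitePlace.maximalIdeal_mk, AlgHom.toRingHom_eq_coe] at h''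
        rw [← ArithPullback.under_asIdeal, h'']
      have hισ : Multiplicative.toAdd (Θ (Algebra.GrothendieckGroup.of (M := hM.Rlf)
          ((((RealificationData.canonical (arithDivisorFunctor F K) (PreFrobenioid.IsPerfFactorialOn.op hΦ)).ofBaseData (PreFrobenioid.biratSubfunctor (ModelFrobenioid.toElem (arithDivisorFunctor F K) (unitsFunctor F K) (divNatTrans F K)))).η.app (op A)).hom (Multiplicative.ofAdd (EffArithDivisor.pullback σ.toAlgHom.toRingHom
            ((Finsupp.single (FinitePlace.mk v) N, 0) : EffArithDivisor A.L)))))) (Sum.inr v) = 0 := by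
        have h := congrArg (fun y : Multiplicative (ADivisor A.L) => Multiplicative.toAdd y (Sum.inr v))
          (hΘι (EffArithDivisor.pullback σ.toAlgHom.toRingHom
            ((Finsupp.single (FinitePlace.mk v) N, 0) : EffArithDivisor A.L)))
        simp only [toAdd_ofAdd, ADivisor.ofArithDivisor_apply_inr, EffArithDivisor.toArithDivisor_fst,
          EffArithDivisor.pullback_fst] at h
        rw [Finsupp.single_eq_of_ne hne, mul_zero, Nat.cast_zero, Int.cast_zero] at h
        exact h
      -- `c_N + d̂ N = 0 + c` with `c_N ≥ 0`, `d̂ ≥ 1`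
      have hnn := hΘnn (div (ρ (a := ⟨A, μ * Algebra.GrothendieckGroup.of wN⟩) (a' := ⟨A, ν * Algebra.GrothendieckGroup.of wN⟩) K')) (Sum.inr v)
      have hd1 : (1 : ℝ) ≤ ((degFr (ρ (a := ⟨A, μ * Algebra.GrothendieckGroup.of wN⟩) (a' := ⟨A, ν * Algebra.GrothendieckGroup.of wN⟩) K') : ℕ) : ℝ) := by
        exact_mod_cast (degFr (ρ (a := ⟨A, μ * Algebra.GrothendieckGroup.of wN⟩) (a' := ⟨A, ν * Algebra.GrothendieckGroup.of wN⟩) K')).pos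
      have hprod : (N : ℝ) ≤ ((degFr (ρ (a := ⟨A, μ * Algebra.GrothendieckGroup.of wN⟩) (a' := ⟨A, ν * Algebra.GrothendieckGroup.of wN⟩) K') : ℕ) : ℝ) * N := le_mul_of_one_le_left N.cast_nonneg hd1
      -- substitute the two `ι`-coordinates (up to definitional unfolding of the atoms)
      have e : Multiplicative.toAdd (Θ (Algebra.GrothendieckGroup.of (M := hM.Rlf) (div (ρ (a := ⟨A, μ * Algebra.GrothendieckGroup.of wN⟩) (a' := ⟨A, ν * Algebra.GrothendieckGroup.of wN⟩) K')))) (Sum.inr v) +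
          ((degFr (ρ (a := ⟨A, μ * Algebra.GrothendieckGroup.of wN⟩) (a' := ⟨A, ν * Algebra.GrothendieckGroup.of wN⟩) K') : ℕ) : ℝ) * (N : ℝ) = 0 + c := by
        convert hcoord using 3 <;> first | rfl | exact hιN.symm | exact hισ.symm
      linarith [e, hnn, hprod]
    have h := key (⌊c⌋₊ + 1)
    push_cast at h
    linarith [Nat.lt_floor_add_one c]
  -- Step 2: an endomorphism of `Spec L` fixing every finite place is the identity
  have hid : σ.toAlgHom = AlgHom.id F A.L :=
    Literature.NumberTheory.NumberFields.algHom_eq_id_of_forall_comap_heightOneSpectrum σ.toAlgHom hfix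
  exact FinSubextCat.hom_ext hid

end FrdI.Cor54Sub

end Literature.AlgebraicGeometry.Frobenioids

end
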